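import Mathlib
import HarnessLib

set_option Elab.async false

/-!
# Kernel witnesses for the image `S₃ ≀ C₂` of `ρ̄_{A,2}`, `A = Jac(353.a.353.1)` (the `N = 353` Galois sub-certificate)

[BPPTVY] = Brumer–Pacetti–Poor–Tornaría–Voight–Yuen, *On the paramodularity of typical abelian surfaces*, ANT 13 (2019)
[cite: BrumerEtAl2019, §7.2 (N = 353): "For A, we find the 2-torsion field generated by the splitting field of the polynomial
x⁶ + 2x⁴ + 2x³ + 5x² + 2x + 1 and Galois group S₃ ≀ C₂"; §5.1–5.2 for `ι : S₆ ≃ Sp₄(𝔽₂)` and `A[2]` as the even-subset module].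
Companion to `KernelFrobeniusTypes.lean` (engineer 1 gen 6: the Dedekind cycle-type witnesses for the images `S₅(b)` of 277/349/461
and `S₆` of 587±, which left out the imprimitive case 353) and to `KernelResidualExclusion353.lean` (gen 8).  Certificate
`certs/353/galois/galois_certificate.json` (sha256 `b5002c9adbe46b73…`): `target.two_division.galois_group` = "S3 wr C2 = 6T13 (order 72):
A polgalois …; B: blocks from the factorization s = cA * conj(cA) over Q(i) + Dedekind cycle types", `block_field.A_blockfield.cubic_factor`
= `x^3 + (1 + 2i)x + 1` (there written with `y = 1 - 2i`-normalisation `x^3 + (-2*y + 1)*x + 1`, `y² - 2y + 5 = 0`; `cA_uv = [[1,0],[1,2],[0,0],[1,0]]`).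

WHAT IS DECIDED (every literal recomputed in Python by `code/eng1g8/kernel_residual/gen_image353.py`, asserted equal to the certificate,
then re-decided by the kernel):
* `block_factorisation`: in `ℤ[i][x]` (`GaussianInt = ℤ√-1`, ascending coefficient lists, Cauchy products),
  `f = c_A · c_B` with `c_A = x³ + (1+2i)x + 1`, `c_B = x³ + (1−2i)x + 1`, and `conj_blocks`: `c_B = conj(c_A)` coefficientwise.
* `type_42_F3`: `f mod 3` squarefree (Bezout `u·f + v·f′ = 1` in `𝔽₃[x]`) with `N₁ = 0` roots in `𝔽₃`, `N₂ = 2` in `𝔽₉` ⇒ pattern `(4,2)`.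
* USED FROM `KernelResidualExclusion353.lean` (same directory, theorem `ResidualExclusion353.curve_F5`, already in the tree — not restated):
  `f mod 5` squarefree with `N₁ = 1`, `N₂ = 3` ⇒ pattern `(3,2,1)`.  (Pattern from `(N₁, N₂)` for a squarefree sextic: table in that file.)

WHY THIS GIVES `Gal(f) = S₃ ≀ C₂` (classical; the semantics of the decided data, NOT formalised — Dedekind–Kummer is not in Mathlib):
let `G = Gal(ℚ(A[2])/ℚ) = Gal(f) ≤ S₆` act on the six roots (`f` is squarefree: it is squarefree mod 3).  UPPER BOUND: every
`σ ∈ Gal(ℚ̄/ℚ)` maps `c_A` to `c_A` or to `c_B = conj(c_A)` (it fixes or conjugates `i`), hence maps the root set `B₁` of `c_A` onto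
`B₁` or onto the root set `B₂` of `c_B`; `B₁ ∩ B₂ = ∅` (squarefree), so `G` preserves the partition `{B₁, B₂}`:
`G ≤ Stab(B₁|B₂) = S₃ ≀ C₂` (order 72), and `G₀ := G ∩ (S₃ × S₃)` (the block-preserving part) has index ≤ 2 in `G`.
LOWER BOUND (Dedekind: for `p ∤ disc`, `Frob_p` has the cycle type of `f mod p`): the cycle types occurring in `S₃ × S₃` are
`1⁶, 2·1⁴, 2²·1², 3·1³, 3·2·1, 3²`; a block-swapping element has only even cycles (`2³, 4·2, 6`).  `Frob₃` has type `(4,2)`, so it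
SWAPS the blocks (`[G : G₀] = 2`; call it `s`).  `Frob₅` has type `(3,2,1)`, so it lies in `G₀` and is `(c, t)` = a 3-cycle `c` on one
block times a transposition `t` on the other; its square is a 3-cycle on one block alone, its cube a transposition on the other block
alone; conjugating these by `s` moves them to the opposite blocks.  Hence `G₀` contains a 3-cycle and a transposition on EACH block,
i.e. `G₀ ⊇ S₃ × S₃`, so `|G| = 2·36 = 72` and `G = S₃ ≀ C₂` (transitive; in particular `f` is irreducible over `ℚ` and `c_A` over `ℚ(i)`,
and the blocks are the root sets of `c_A`, `c_B` over the block field `ℚ(i) = ℚ(√-1)`, `disc = -4` as in the certificate).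
This is the third independent determination (impl A: PARI `polgalois` = [72, -1, 1, "S(3) wr 2"]; impl B: the same blocks + Dedekind
types against all 112 subgroups of `S₃ ≀ C₂`, GAP-free Python; here: recomputation + Lean kernel).
-/

namespace Literature.NumberTheory.FaltingsSerre.KernelCounts.Image353

/-- `f = c_A · c_B` in `ℤ[i][x]`: for every `k ≤ 6`, `Σ_{j ≤ k} (c_A)_j (c_B)_{k-j} = f_k`, with `c_A = [1, 1+2i, 0, 1]`, `c_B = [1, 1−2i, 0, 1]`,
`f = [1, 2, 5, 2, 2, 0, 1]` (ascending coefficients; `f = x⁶ + 2x⁴ + 2x³ + 5x² + 2x + 1 = 4P + Q²` for 353.a.353.1, [BPPTVY §7.2]). [cite: BrumerEtAl2019, §7.2] -/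
theorem block_factorisation : ∀ k < 7,
    (∑ j ∈ Finset.range (k + 1), ([⟨1, 0⟩, ⟨1, 2⟩, ⟨0, 0⟩, ⟨1, 0⟩] : List GaussianInt).getD j 0 * ([⟨1, 0⟩, ⟨1, -2⟩, ⟨0, 0⟩, ⟨1, 0⟩] : List GaussianInt).getD (k - j) 0) =
    ([⟨1, 0⟩, ⟨2, 0⟩, ⟨5, 0⟩, ⟨2, 0⟩, ⟨2, 0⟩, ⟨0, 0⟩, ⟨1, 0⟩] : List GaussianInt).getD k 0 := by
  decide +kernel

/-- `c_B` is the complex conjugate of `c_A`, coefficientwise (`star` on `ℤ[i]`); = certificate `block_field.A_factorK0.cB_uv`. [folklore] -/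
theorem conj_blocks : ([⟨1, 0⟩, ⟨1, 2⟩, ⟨0, 0⟩, ⟨1, 0⟩] : List GaussianInt).map star = ([⟨1, 0⟩, ⟨1, -2⟩, ⟨0, 0⟩, ⟨1, 0⟩] : List GaussianInt) := by
  decide +kernel

/-- `f mod 3`: Bezout `u·f + v·f′ = 1` in `𝔽_3[x]` (`u = [2, 1, 1]`, `v = [1, 0, 1, 2, 1, 1]`; squarefree), `N₁ = 0` roots in `𝔽_3`, `N₂ = 2` in `𝔽_9 = QuadraticAlgebra (ZMod 3) 2 0`:
pattern (4,2) — a block swap. [cite: LMFDB, genus-2 curve 353.a.353.1] -/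
theorem type_42_F3 :
    (∀ i < 11, (∑ j ∈ Finset.range (i + 1), ([2, 1, 1] : List (ZMod 3)).getD j 0 * ([1, 2, 5, 2, 2, 0, 1] : List (ZMod 3)).getD (i - j) 0) +
      (∑ j ∈ Finset.range (i + 1), ([1, 0, 1, 2, 1, 1] : List (ZMod 3)).getD j 0 * ([2, 10, 6, 8, 0, 6] : List (ZMod 3)).getD (i - j) 0) = if i = 0 then 1 else 0) ∧
    (Finset.univ.filter fun x : ZMod 3 => ((((x * x + 2) * x + 2) * x + 5) * x + 2) * x + 1 = 0).card = 0 ∧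
    (letI : Fintype (QuadraticAlgebra (ZMod 3) 2 0) := Fintype.ofEquiv _ (QuadraticAlgebra.equivProd (2 : ZMod 3) 0).symm;
      (Finset.univ.filter fun x : QuadraticAlgebra (ZMod 3) 2 0 => ((((x * x + 2) * x + 2) * x + 5) * x + 2) * x + 1 = 0).card) = 2 := by
  refine ⟨by decide +kernel, by decide +kernel, by decide +kernel⟩

end Literature.NumberTheory.FaltingsSerre.KernelCounts.Image353
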